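/-
Origin: expansion seat `planner-pub-hodgecm-pv13-g3-0`, handover #3 2026-08-18T06:42:04Z (`HOME/pub-hodgecm-pv13-g3/lean/Pv13g3/SplitHaar.lean`, md5 f0b8136b, 202 lines);
landed by the gen-7 packager in gate run 25 as `HodgeCM/PerL34/SplitHaar.lean` (import ^import Pv13g3\.→import HodgeCM.PerL34. ×1).
-/
/-
Copyright: HodgeCM publication cell (pub-hodgecm), DAG node N31 — seam S3, END FORM over the Haar datum with the
split places DERIVED (prover pv13, gen 3).  Released under the package licence.

# `θ ≠ 0` over the Haar datum with split-place models instead of shell hypotheses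

Source under adjudication (NOT cited as a fact; this file COMPOSES proved pieces of it):
PerL v5 = `inputs/2001/summits__hodge-w-picard-modular-quadrilinear-period-galois-
closure__free__y1__paper__paper.tex` (= `…__work__paper-v5-d912a121.tex`, 738 l.), Lemma 4.2(b), proof,
tex ll. 628–632, VERBATIM:

  628–632: Enlarging $S$, for $v\notin S$ also $\phi_v=\phi_v^0$ and all splitting data are unramified,
           and $I_v(\phi^0_v)=1$ resp.\ $I_v(\phi^0_v)=\sum_{n\in\Z}q_v^{-3|n|/2}a_v^{n}=(1-q_v^{-3})\,
           |1-a_vq_v^{-3/2}|^{-2}$ at split $v$, where $a_v:=\chi'_v(\varpi_v)\nu_v(\varpi_v)$ with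
           $\nu_v$ the (unramified) auxiliary character of the Weil representation, $|a_v|=1$ (measures
           giving the maximal compact subgroups volume $1$). Hence $\prod_vI_v(\phi_v)$ converges
           absolutely to a positive number for suitable $\phi$, so $\langle\theta_\phi(\chi'),
           \theta_\phi(\chi')\rangle>0$ and $\pi_i\ne0$.

## What this file does (composition BY NAME; no new mathematics)

pv09-g3's END THEOREM over the HAAR datum (`PureTensor.theta_ne_zero_levels_of_places`,
`CharContinuity.lean`, run 24: compact fundamental domain, levels `K_T`/`K_{T′}`, LOCAL continuity only,
number-field places) takes the per-place structure `X : UnramifiedPlaceData …` as an INPUT.  Here `X` is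
BUILT from split-place models (this seat's `SplitShells.unramifiedPlaceDataOfModels`, handover #2):
* `isMulLeftInvariant_haarDatum_ν` — the local Haar measures of the Haar datum are left invariant
  (instance, by `rw`; cf. pv09-g3's `isInvInvariant_haarDatum_ν`; pv09-g3's run-25 `NonsplitWitness`
  registers the same instance as `PureTensor.isMulLeftInvariant_haarDatum_ν` — distinct FQ name, either
  suffices);
* **`SplitShells.SplitPlaceModel.ofHaar`** — over the Haar datum a split-place model needs NO measure
  fields (`B i` is open hence measurable; `ν_i(B i) = 1` is pv09-g3's `haarDatum_ν_self` — "measures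
  giving the maximal compact subgroups volume 1", l. 631–632);
* **`theta_ne_zero_levels_of_splitModels`** — pv09-g3's `theta_ne_zero_levels_of_places` with
  `X := unramifiedPlaceDataOfModels …`: the split-place input is a family of `SplitPlaceModel`s;
* **`theta_ne_zero_levels_of_dilation`** — the same with every split model produced by the D4
  dictionary `SplitPlaceDilation.splitPlaceModelOfDilation` (pv07-g2's dilation model, `q_v :=
  LocalModulus.resIndex ϖF_v` KERNEL) under the displayed BOOKKEEPING hypothesis
  `hq : resIndex (ϖF j) = N(e j)` (`[𝒪_v : ϖ_v𝒪_v] = N(v)`; its `ℚ_p` instance is pv07-g2's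
  `resIndex_padic`), which also feeds pv13's `EulerProduct.summable_tOf_of_places`.  After this theorem
  the per-place input at a split unramified place is EXACTLY: the place valuation `ord_v` with kernel
  `B_v` and uniformizer, the invariances `fixed`/`unram` (l. 628 "φ_v = φ_v⁰ and all splitting data are
  unramified"), `ν_v` unramified, `vol(𝒪_v³) = 1`, the ONE dictionary identification `coeff_eq`
  (l. 610–611), and a uniformizer `ϖF_v` of the local field with `hq`.
Nothing is cited; no hypothesis names PerL, QW8 or a 2001-programme claim.  Axioms = the standard trio.
Unit `pub-hodgecm-pv13-g3` (DAG-node prover #13, generation 3), 2026-08-18.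

Imports: `Pv13g3.SplitPlaceDilation` ↦ `HodgeCM.PerL34.SplitPlaceDilation` (this seat, handover #2) and the
LANDED (run 24) `HodgeCM.PerL34.CharContinuity` (pv09-g3).
-/
import Summits.HodgeConjecture.HodgeCM.PerL34.SplitPlaceDilation
import Summits.HodgeConjecture.HodgeCM.PerL34.CharContinuity

set_option autoImplicit false

noncomputable section

open MeasureTheory MeasureTheory.Measure Set Metric Function Complex ComplexConjugate

open scoped RestrictedProduct InnerProductSpace NNReal

namespace HodgeCM.PerL34.SplitShells

open HodgeCM.PerL34.PureTensor HodgeCM.PerL34.AdelicFactorisation HodgeCM.PerL34.RestrictedMeasure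
  HodgeCM.PerL34.EulerFactorisation HodgeCM.PerL34.NoSmallSubgroups HodgeCM.PerL34.LocalFactors.DilationModel
  HodgeCM.PerL34.LocalModulus HodgeCM.PerL34.SplitPlaceDilation

/-! ## §1 Split-place models over the Haar datum -/

section ofHaar

variable {ι : Type} {G : ι → Type} [∀ i, CommGroup (G i)] [∀ i, TopologicalSpace (G i)]
  [∀ i, IsTopologicalGroup (G i)] [∀ i, T2Space (G i)] [∀ i, SecondCountableTopology (G i)]
  [∀ i, LocallyCompactSpace (G i)] [∀ i, MeasurableSpace (G i)] [∀ i, BorelSpace (G i)]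
  [Countable ι] [DecidableEq ι]
  (B : ∀ i, Subgroup (G i)) (hBc : ∀ i, IsCompact (B i : Set (G i)))
  (hBo : ∀ i, IsOpen (B i : Set (G i))) (S₀ : Finset ι)
  {Sp : Type} [NormedAddCommGroup Sp] [InnerProductSpace ℂ Sp]
  (ω : (Πʳ j, [G j, B j]) →* (Sp ≃ₗᵢ[ℂ] Sp)) (φ : Sp) (χ : (Πʳ j, [G j, B j]) →* Circle)

/-- the local Haar measures of the Haar datum are left invariant (Mathlib; recorded as an instance on the
datum's `ν i`, cf. pv09-g3 `isInvInvariant_haarDatum_ν`) -/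
instance isMulLeftInvariant_haarDatum_ν (i : ι) : ((haarDatum B hBc hBo S₀).ν i).IsMulLeftInvariant := by
  rw [haarDatum_ν]
  infer_instance

/-- **A split-place model over the Haar datum** needs no measure fields: `B i` is open (measurable) and
`ν_i(B i) = 1` by construction of the Haar datum. -/
def SplitPlaceModel.ofHaar (i : ι) {q : ℕ} {chiPi nuPi : ℂ} (ord : G i →* Multiplicative ℤ) (ϖ : G i)
    (ord_ϖ : ord ϖ = Multiplicative.ofAdd 1) (ker_ord : ∀ g : G i, ord g = 1 ↔ g ∈ B i)
    (fixed : ∀ b : G i, b ∈ B i → ω (RestrictedProduct.mulSingle B i b) φ = φ)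
    (unram : ∀ b : G i, b ∈ B i → χ (RestrictedProduct.mulSingle B i b) = 1)
    (chiPi_eq : ((χ (RestrictedProduct.mulSingle B i ϖ) : Circle) : ℂ) = chiPi)
    (coeff_zpow : ∀ n : ℤ,
      localCoeff B ω φ i (ϖ ^ n) = ((EulerProduct.tOf q : ℝ) : ℂ) ^ n.natAbs * nuPi ^ n) :
    SplitPlaceModel B (haarDatum B hBc hBo S₀) ω φ χ i q chiPi nuPi where
  ord := ord
  ϖ := ϖ
  ord_ϖ := ord_ϖ
  ker_ord := ker_ord
  measurableSet_B := (hBo i).measurableSet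
  vol_B := haarDatum_ν_self B hBc hBo S₀ i
  fixed := fixed
  unram := unram
  chiPi_eq := chiPi_eq
  coeff_zpow := coeff_zpow

end ofHaar

/-! ## §2 The end theorems (pv09-g3's `theta_ne_zero_levels_of_places` with the split places derived) -/

section endTheorems

open ComplexConjugate

variable {ι : Type} {G : ι → Type} [∀ i, CommGroup (G i)] [∀ i, TopologicalSpace (G i)]
  [∀ i, IsTopologicalGroup (G i)] [∀ i, T2Space (G i)] [∀ i, SecondCountableTopology (G i)]
  [∀ i, LocallyCompactSpace (G i)] [∀ i, MeasurableSpace (G i)] [∀ i, BorelSpace (G i)]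
  [Countable ι] [DecidableEq ι]
  (B : ∀ i, Subgroup (G i)) (hBc : ∀ i, IsCompact (B i : Set (G i)))
  (hBo : ∀ i, IsOpen (B i : Set (G i))) (S₀ : Finset ι)
  {Sp : Type} [NormedAddCommGroup Sp] [InnerProductSpace ℂ Sp]
  {E : Type*} [NormedAddCommGroup E] [InnerProductSpace ℂ E]
  (ω : (Πʳ j, [G j, B j]) →* (Sp ≃ₗᵢ[ℂ] Sp)) (φ : Sp) (hφ : ‖φ‖ = 1)
  (hloc : ∀ (i : ι) (v : Sp), Continuous fun g : G i => ω (RestrictedProduct.mulSingle B i g) v)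
  (χ : (Πʳ j, [G j, B j]) →* Circle) {T' : Finset ι}
  (hχT' : RestrictedProduct.boxSubgroup B T' ≤ χ.ker)
  (hlocχ : ∀ i ∈ T', Continuous fun g : G i => χ (RestrictedProduct.mulSingle B i g))
  (𝓕 : Set (Πʳ j, [G j, B j])) (h𝓕c : IsCompact 𝓕) (h𝓕i : (interior 𝓕).Nonempty)
  (K : (Πʳ j, [G j, B j]) → (Πʳ j, [G j, B j]) → ℂ) (c : ℝ) (c_pos : 0 < c) (θ : E) (Θ : Set E)
  (hθ : θ ∈ Θ)
  (hN31e : RallisIP.N31e_statement (haarDatum B hBc hBo S₀).μ 𝓕 ω φ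
    (fun y => ((χ y : Circle) : ℂ)) K (c : ℂ))
  (hnorm : ⟪θ, θ⟫_ℂ = ∫ u in 𝓕, ∫ u' in 𝓕, ((χ u : Circle) : ℂ) * conj ((χ u' : Circle) : ℂ) *
    K u u' ∂(haarDatum B hBc hBo S₀).μ ∂(haarDatum B hBc hBo S₀).μ)
  {T : Finset ι} (hK : ∀ k ∈ RestrictedProduct.boxSubgroup B T, ω k φ = φ)
  (hM : ∀ S : Finset ι, T ⊆ S → ∀ y : (i : ↥S) → G i,
    inner ℂ φ (ω (extendOne B S y) φ) = ∏ i : ↥S, localCoeff B ω φ i (y i))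
  {S : Finset ι} {IsSplit : ι → Prop}
  (hBi : ∀ i, i ∉ S → ¬IsSplit i → (B i : Set (G i)) = Set.univ)
  (hν1 : ∀ i, i ∉ S → ¬IsSplit i → (haarDatum B hBc hBo S₀).ν i Set.univ = 1)
  (hTS : T ⊆ S) (hT'S : T' ⊆ S)
  (hclS : ∀ i ∈ S, Integrable (localCoeff B ω φ i) ((haarDatum B hBc hBo S₀).ν i))
  (ram_pos : ∀ i ∈ S, 0 < (localIntegrand B (haarDatum B hBc hBo S₀) ω φ χ i).I)
  (L₀ : Type*) [Field L₀] [NumberField L₀]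
  (e : {j : ι // j ∉ S} → IsDedekindDomain.HeightOneSpectrum (NumberField.RingOfIntegers L₀))
  (he : Function.Injective e)

include hφ hloc hχT' hlocχ h𝓕c h𝓕i c_pos hθ hN31e hnorm hK hM hBi hν1 hTS hT'S hclS ram_pos he

/-- **`θ ≠ 0`, canonical Haar data / compact fundamental domain / levels / LOCAL continuity / number-field
places, with the split places given by MODELS** (pv09-g3 `theta_ne_zero_levels_of_places` with
`X := unramifiedPlaceDataOfModels …`): the six shell hypotheses per split place are theorems. -/
theorem theta_ne_zero_levels_of_splitModels {q : ι → ℕ} {chiPi nuPi : ι → ℂ}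
    (M : ∀ i, i ∉ S → IsSplit i →
      SplitPlaceModel B (haarDatum B hBc hBo S₀) ω φ χ i (q i) (chiPi i) (nuPi i))
    (two_le_q : ∀ i, i ∉ S → 2 ≤ q i) (chi_norm : ∀ i, i ∉ S → ‖chiPi i‖ = 1)
    (nu_norm : ∀ i, i ∉ S → ‖nuPi i‖ = 1)
    (hq : ∀ j : {j : ι // j ∉ S}, q j.1 = Ideal.absNorm (e j).asIdeal) : θ ≠ 0 :=
  theta_ne_zero_levels_of_places B hBc hBo S₀ ω φ hφ hloc χ hχT' hlocχ 𝓕 h𝓕c h𝓕i K c c_pos θ Θ hθ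
    hN31e hnorm hK hM (unramifiedPlaceDataOfModels B (haarDatum B hBc hBo S₀) ω φ χ M hBi hν1 two_le_q
      chi_norm nu_norm) hTS hT'S hclS ram_pos L₀ e he hq

/-- **`θ ≠ 0`, same setting, split places from the DILATION MODEL** — the end form of the split side of
seam S3.  Per split place `i ∉ S` the inputs are: the place valuation `ord i` with kernel `B i` and
uniformizer `ϖ i`, the two unramifiedness invariances `fixed` / `unram`, `ν i` unramified, `vol(𝒪_v³) = 1`
and the ONE dictionary identification `coeff_eq`; at every place `i ∉ S` an element `ϖF i` of the local
field `F i` of norm `< 1` with the bookkeeping `hq : [𝒪 : ϖF·𝒪] = N(v)` (i.e. a uniformizer).  The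
numbers `q_v := resIndex (ϖF v)`, `χ′_v(ϖ_v)`, `ν_v(ϖ_v)` and the facts `2 ≤ q_v`, `|a_v| = 1`, the six
shell facts and `Σ_v q_v^{-3/2} < ∞` are all THEOREMS (this seat #1/#2, pv07-g2, pv13 `EulerProduct`). -/
theorem theta_ne_zero_levels_of_dilation
    (F : ι → Type) [∀ i, NontriviallyNormedField (F i)] [∀ i, IsUltrametricDist (F i)]
    [∀ i, ProperSpace (F i)] [∀ i, MeasurableSpace (Fin 3 → F i)] [∀ i, BorelSpace (Fin 3 → F i)]
    (μV : ∀ i, Measure (Fin 3 → F i)) [∀ i, (μV i).IsAddHaarMeasure] (ρ : ι → ℝ)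
    (ν : ∀ i, (F i)ˣ →* Circle) (ord : ∀ i, G i →* Multiplicative ℤ) (ϖ : ∀ i, G i)
    (ϖF : ∀ i, (F i)ˣ)
    (ord_ϖ : ∀ i, i ∉ S → IsSplit i → ord i (ϖ i) = Multiplicative.ofAdd 1)
    (ker_ord : ∀ i, i ∉ S → IsSplit i → ∀ g : G i, ord i g = 1 ↔ g ∈ B i)
    (fixed : ∀ i, i ∉ S → IsSplit i → ∀ b : G i, b ∈ B i → ω (RestrictedProduct.mulSingle B i b) φ = φ)
    (unram : ∀ i, i ∉ S → IsSplit i → ∀ b : G i, b ∈ B i → χ (RestrictedProduct.mulSingle B i b) = 1)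
    (hν : ∀ i, i ∉ S → IsSplit i → ∀ u : (F i)ˣ, ‖(u : F i)‖ = 1 → ν i u = 1)
    (hvol : ∀ i, i ∉ S → IsSplit i → (μV i).real (closedBall (0 : Fin 3 → F i) (ρ i)) = 1)
    (coeff_eq : ∀ i, i ∉ S → IsSplit i → ∀ n : ℤ, localCoeff B ω φ i (ϖ i ^ n)
      = ⟪ballIndicator (μV i) 0 (ρ i), dilationRep (μV i) (ν i) (ϖF i ^ n) (ballIndicator (μV i) 0 (ρ i))⟫_ℂ)
    (hϖF : ∀ i, i ∉ S → ‖(ϖF i : F i)‖ < 1)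
    (hq : ∀ j : {j : ι // j ∉ S}, resIndex (ϖF j.1) = Ideal.absNorm (e j).asIdeal) : θ ≠ 0 := by
  classical
  -- the split-place models from the dilation dictionary (`q_v := resIndex (ϖF v)` KERNEL, pv07-g2 + #1)
  have M : ∀ i, i ∉ S → IsSplit i → SplitPlaceModel B (haarDatum B hBc hBo S₀) ω φ χ i
      (resIndex (ϖF i)) (((χ (RestrictedProduct.mulSingle B i (ϖ i)) : Circle) : ℂ))
      (((ν i (ϖF i) : Circle) : ℂ)) := fun i hi hs =>
    splitPlaceModelOfDilation B (haarDatum B hBc hBo S₀) ω φ χ (μV i) (ρ i) (ν i) i (ord i) (ϖ i)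
      (ord_ϖ i hi hs) (ker_ord i hi hs) (hBo i).measurableSet (haarDatum_ν_self B hBc hBo S₀ i)
      (fixed i hi hs) (unram i hi hs) (ϖF i) (hϖF i hi) (hν i hi hs) (hvol i hi hs)
      (coeff_eq i hi hs)
  exact theta_ne_zero_levels_of_splitModels B hBc hBo S₀ ω φ hφ hloc χ hχT' hlocχ 𝓕 h𝓕c h𝓕i K c c_pos
    θ Θ hθ hN31e hnorm hK hM hBi hν1 hTS hT'S hclS ram_pos L₀ e he M
    (fun i hi => two_le_resIndex (hϖF i hi)) (fun i _ => norm_chiPi B χ i (ϖ i))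
    (fun i _ => norm_nuPi (ν i) (ϖF i)) hq

end endTheorems

end HodgeCM.PerL34.SplitShells
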